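import Mathlib
import HarnessLib
import Literature.Analysis.InnerProduct.SubspaceResidualClusterBound

/-!
# Lehmann's optimal intervals (right-definite Lehmann–Maehly bounds) in counting form

Topic `Literature/Analysis/InnerProduct`, namespace `Literature.Analysis.InnerProduct`.  Cell certnum
(CERTIFIED-NUMERICS STACK, D-0105 (6)), layer L4; certnum-lit-1 FACT line F1-7-interior («Lehmann's
INTERIOR / indexed optimal intervals around an arbitrary shift `ρ`»; the bottom-of-spectrum block
form is `Literature.Analysis.OperatorTheory.DeflatedFormBound`, the Goerisch/left-definite counting
form is `Literature.Analysis.OperatorTheory.lehmann_goerisch_count`).  HONEST FRAMING: a proved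
counting inequality for a finite-dimensional symmetric operator / Hermitian matrix; it certifies no
engine output.  WHAT THIS IS NOT: not the left-definite (harmonic) Lehmann bounds; not the
optimality statement; not the PDE/operator setting with essential spectrum.

SOURCE (read on the page): C. Beattie, *Variations of Ritz and Lehmann bounds* (1998),
arXiv:math/9805029 [held: `paper:arxiv-math_9805029` chunk p0006], §2 «Lehmann's Optimal
Intervals».  Verbatim (right-definite method): «Fix a scalar `ρ` that is not an eigenvalue … and
define the index `r` to satisfy `λ_{r−1} < ρ < λ_r`. The right-definite Lehmann method follows
first from considering the spectral mapping `λ ↦ 1/(λ − ρ)` and an associated eigenvalue problem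
`M(K − ρM)⁻¹Mx = (1/(λ − ρ)) Mx` … Now use an `m`-dimensional subspace `𝒮 = Ran(S)` to generate
Rayleigh–Ritz estimates … `[SᵗM(K − ρM)⁻¹MS] y = R [SᵗMS] y`. Suppose (it) has `ν` negative
eigenvalues `R₁ ≤ ⋯ ≤ R_ν < 0` and `π = m − ν` positive eigenvalues `0 < R_{−π} ≤ ⋯ ≤ R_{−1}`.
Regardless of the subspace `𝒮` that is chosen, the min-max principle guarantees that for each
`k = 1, …, ν` and `ℓ = 1, …, π`: `1/(λ_{r−k} − ρ) ≤ R_k` and `R_{−ℓ} ≤ 1/(λ_{r+ℓ−1} − ρ)`. Rearrange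
and introduce `Λ^{(R)}_{−k} := ρ + 1/R_k ≤ λ_{r−k}` and `λ_{r+ℓ−1} ≤ ρ + 1/R_{−ℓ} =: Λ^{(R)}_ℓ` … An
equivalent statement … is: Each of the intervals `[Λ^{(R)}_{−k}, ρ)` and `(ρ, Λ^{(R)}_ℓ]` contain
respectively `k` and `ℓ` eigenvalues … To avoid … solving linear systems … change variables as
`P = (K − ρM)⁻¹MS` …: `[Pᵗ(K − ρM)P] y = R [Pᵗ(K − ρM)M⁻¹(K − ρM)P] y`. When `dim 𝒫 = 1`, (this)
becomes Temple's inequality.»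

## What is typed (standard problem `M = I`; `𝕜 = ℝ` or `ℂ`)
The COUNTING content of the right-definite bounds, in the variables `P` (so no linear system and no
inverse appears), for an ARBITRARY trial subspace: if `W` is a subspace (of dimension `k`) on which
`‖(T − ρ)u‖² ≤ τ · re⟪(T − ρ)u, u⟫` for all `u ∈ W` — for `τ = 1/R < 0` this is «the Rayleigh
quotient of `(T − ρ)⁻¹` on `(T − ρ)W` is `≤ R`», i.e. `W` = span of Lehmann–Ritz vectors with
Ritz values `≤ R_k`, and symmetrically for `τ = 1/R > 0` — then AT LEAST `k` eigenvalues of `T` lie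
in the closed interval with endpoints `ρ` and `ρ + τ` (= `[Λ_{−k}, ρ]`, resp. `[ρ, Λ_ℓ]`; the
endpoint `ρ` drops out when `ρ` is not an eigenvalue, which is NOT assumed here).
PROOF (one line, and the reason no spectral mapping is needed in Lean): with `B = T − ρ` and
`c = ρ + τ/2`, `‖(T − c)u‖² = ‖Bu‖² − τ re⟪Bu, u⟫ + (τ/2)²‖u‖² ≤ (τ/2)²‖u‖²` on `W`, so Kahan's
cluster theorem (`finrank_le_card_abs_eigenvalues_sub_le_of_sq`, tree) gives `k` eigenvalues within
`|τ|/2` of `c`.  For `k = 1` this is Temple's inequality in Kato's form (the tree's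
`Literature.Analysis.OperatorTheory.kato_temple_enclosure` / `DeflatedFormBound.templeFormBound`).
Matrix form for a verifier: `lehmann_card_le_card_eigenvalues_of_frame` (Hermitian `A`, full-rank
frame `P : Matrix m k 𝕜`, the `k × k` inequality in sums-of-squares / `star·dotProduct` form).

## Search record (TYPER LINT RULE)
`lean search 'Lehmann|Maehly|optimal interval'`: tree has the Goerisch/left-definite COUNT
(`OperatorTheory/LehmannGoerisch.lean`) with spectral input below `ρ`, the `k`-vector Temple /
Lehmann–Maehly VALUE bound for the BOTTOM eigenvalue (`OperatorTheory/DeflatedFormBound.lean`),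
Kato–Temple for one vector, Kahan's cluster theorem (`SubspaceResidualClusterBound.lean`) — but no
right-definite Lehmann interval count around an arbitrary shift; certnum typed/INDEX.tsv L1 row
«Lehmann–Maehly / Lehmann–Goerisch» notes exactly this remainder (lit-1 F1-7-interior).

AI-produced formalisation (cell certnum, seat certnum-lean-1, 2026-08-26).
-/

set_option autoImplicit false

noncomputable section

open scoped InnerProductSpace ComplexConjugate
open Module Finset

namespace Literature.Analysis.InnerProduct

variable {𝕜 : Type*} [RCLike 𝕜] {E : Type*} [NormedAddCommGroup E] [InnerProductSpace 𝕜 E]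
  [FiniteDimensional 𝕜 E] {T : E →ₗ[𝕜] E} {n : ℕ}

omit [FiniteDimensional 𝕜 E] in
/-- The completed square behind the right-definite Lehmann bound: for `B = T − ρ`, `c = ρ + τ/2`,
`‖T u − c u‖² = ‖B u‖² − τ re⟪B u, u⟫ + (τ/2)² ‖u‖²`. [folklore] -/
private theorem norm_sq_sub_center (T : E →ₗ[𝕜] E) (ρ τ : ℝ) (u : E) :
    ‖T u - ((ρ + τ / 2 : ℝ) : 𝕜) • u‖ ^ 2 =
      ‖T u - (ρ : 𝕜) • u‖ ^ 2 - τ * RCLike.re ⟪T u - (ρ : 𝕜) • u, u⟫_𝕜 + (τ / 2) ^ 2 * ‖u‖ ^ 2 := by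
  have hsplit : T u - ((ρ + τ / 2 : ℝ) : 𝕜) • u = (T u - (ρ : 𝕜) • u) - ((τ / 2 : ℝ) : 𝕜) • u := by
    rw [RCLike.ofReal_add, add_smul]; abel
  rw [hsplit, @norm_sub_sq 𝕜, inner_smul_right, norm_smul, RCLike.norm_ofReal, mul_pow, sq_abs]
  have h : RCLike.re (((τ / 2 : ℝ) : 𝕜) * ⟪T u - (ρ : 𝕜) • u, u⟫_𝕜) =
      τ / 2 * RCLike.re ⟪T u - (ρ : 𝕜) • u, u⟫_𝕜 := RCLike.re_ofReal_mul _ _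
  rw [h]; ring

/-- **Right-definite Lehmann bounds, counting form** (Lehmann 1949/1963, Maehly; Beattie 1998 §2,
the statement «each of the intervals `[Λ_{−k}, ρ)` / `(ρ, Λ_ℓ]` contains `k` / `ℓ` eigenvalues» in
subspace form).  Let `T` be symmetric on `E` (`dim E = n`, eigenvalues `hT.eigenvalues hn`), `ρ, τ`
real, and `W` a subspace such that `‖T u − ρu‖² ≤ τ · re⟪T u − ρu, u⟫` for every `u ∈ W` (with
`τ = 1/R`: the Lehmann–Ritz condition for the mapped operator `(T − ρ)⁻¹` with Ritz value bound
`R`, written in the variables `P = (T − ρ)⁻¹S` so that no inverse occurs).  Then at least `dim W`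
eigenvalues `λ_i` of `T` satisfy `|λ_i − (ρ + τ/2)| ≤ |τ|/2`, i.e. lie in the closed interval with
endpoints `ρ` and `ρ + τ = ρ + 1/R`.  (For `k = dim W = 1` this is Temple's inequality.)
[cite: Beattie1998, §2 (right-definite Lehmann bounds)] -/
theorem lehmann_finrank_le_card_eigenvalues (hT : T.IsSymmetric) (hn : finrank 𝕜 E = n)
    (W : Submodule 𝕜 E) {ρ τ : ℝ}
    (hW : ∀ u ∈ W, ‖T u - (ρ : 𝕜) • u‖ ^ 2 ≤ τ * RCLike.re ⟪T u - (ρ : 𝕜) • u, u⟫_𝕜) :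
    finrank 𝕜 W ≤ #{i : Fin n | |hT.eigenvalues hn i - (ρ + τ / 2)| ≤ |τ| / 2} := by
  refine finrank_le_card_abs_eigenvalues_sub_le_of_sq hT hn W (by positivity) fun u hu => ?_
  have hτ : (|τ| / 2) ^ 2 = (τ / 2) ^ 2 := by rw [div_pow, div_pow, sq_abs]
  rw [norm_sq_sub_center T ρ τ u, hτ]
  nlinarith [hW u hu]

/-- The same conclusion written as membership in the Lehmann interval: `|λ − (ρ + τ/2)| ≤ |τ|/2`
iff `min ρ (ρ + τ) ≤ λ ≤ max ρ (ρ + τ)`. [folklore] -/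
private theorem abs_sub_center_le_iff (lam ρ τ : ℝ) :
    |lam - (ρ + τ / 2)| ≤ |τ| / 2 ↔ min ρ (ρ + τ) ≤ lam ∧ lam ≤ max ρ (ρ + τ) := by
  rw [abs_le]
  rcases le_or_gt 0 τ with hτ | hτ
  · rw [abs_of_nonneg hτ, min_eq_left (by linarith), max_eq_right (by linarith)]
    constructor <;> intro h <;> constructor <;> linarith [h.1, h.2]
  · rw [abs_of_neg hτ, min_eq_right (by linarith), max_eq_left (by linarith)]
    constructor <;> intro h <;> constructor <;> linarith [h.1, h.2]

/-- **Right-definite Lehmann bounds, interval form**: under the hypothesis of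
`lehmann_finrank_le_card_eigenvalues`, at least `dim W` eigenvalues lie in
`[min ρ (ρ + τ), max ρ (ρ + τ)]` — Beattie's `[Λ_{−k}, ρ]` for `τ = 1/R_k < 0` and `[ρ, Λ_ℓ]` for
`τ = 1/R_{−ℓ} > 0`. [cite: Beattie1998, §2 (right-definite Lehmann bounds)] -/
theorem lehmann_finrank_le_card_eigenvalues_mem_Icc (hT : T.IsSymmetric) (hn : finrank 𝕜 E = n)
    (W : Submodule 𝕜 E) {ρ τ : ℝ}
    (hW : ∀ u ∈ W, ‖T u - (ρ : 𝕜) • u‖ ^ 2 ≤ τ * RCLike.re ⟪T u - (ρ : 𝕜) • u, u⟫_𝕜) :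
    finrank 𝕜 W ≤
      #{i : Fin n | min ρ (ρ + τ) ≤ hT.eigenvalues hn i ∧ hT.eigenvalues hn i ≤ max ρ (ρ + τ)} := by
  have h := lehmann_finrank_le_card_eigenvalues hT hn W hW
  refine h.trans (Finset.card_le_card fun i hi => ?_)
  simp only [Finset.mem_filter, Finset.mem_univ, true_and] at hi ⊢
  exact (abs_sub_center_le_iff _ _ _).1 hi

/-! ### Hermitian matrices in coordinates (the form a verifier instantiates) -/

section Matrix

open Matrix WithLp

variable {m k : Type*} [Fintype m] [DecidableEq m] [Fintype k] [DecidableEq k]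

/-- **Right-definite Lehmann bounds for a Hermitian matrix and a frame** (counting form).  Let `A`
be Hermitian, `P : Matrix m k 𝕜` a frame with full column rank (`P y = 0 ⇒ y = 0`), `ρ, τ` real, and
suppose the `k × k` Lehmann inequality holds in coordinates: for every `y`,
`Σ_i ‖((AP − ρP) y)_i‖² ≤ τ · re( star(P y) ⬝ ((AP − ρP) y) )` (i.e. the matrix
`τ · Pᴴ(A − ρ)P − Pᴴ(A − ρ)²P = τ(H₁ − ρH₂) − (H₀ − 2ρH₁ + ρ²H₂)` is positive semidefinite, in
Beattie's Schwarz-constant notation).  Then at least `|k|` eigenvalues of `A` satisfy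
`|λ − (ρ + τ/2)| ≤ |τ|/2`. [cite: Beattie1998, §2 (right-definite Lehmann bounds)] -/
theorem lehmann_card_le_card_eigenvalues_of_frame {A : Matrix m m 𝕜} (hA : A.IsHermitian)
    (P : Matrix m k 𝕜) (hP : ∀ y : k → 𝕜, P *ᵥ y = 0 → y = 0) {ρ τ : ℝ}
    (hL : ∀ y : k → 𝕜, ∑ i, ‖((A * P - (ρ : 𝕜) • P) *ᵥ y) i‖ ^ 2 ≤
      τ * RCLike.re (star (P *ᵥ y) ⬝ᵥ ((A * P - (ρ : 𝕜) • P) *ᵥ y))) :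
    Fintype.card k ≤ #{i : m | |hA.eigenvalues i - (ρ + τ / 2)| ≤ |τ| / 2} := by
  classical
  -- the trial subspace `K = range P` in `EuclideanSpace`
  let Pl : EuclideanSpace 𝕜 k →ₗ[𝕜] EuclideanSpace 𝕜 m := toEuclideanLin P
  have hPl : ∀ z : EuclideanSpace 𝕜 k, Pl z = toLp 2 (P *ᵥ ofLp z) := fun z => rfl
  have hPinj : Function.Injective Pl := by
    intro z₁ z₂ h
    have h' : P *ᵥ (ofLp z₁ - ofLp z₂) = 0 := by
      rw [Matrix.mulVec_sub, sub_eq_zero]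
      have := congrArg ofLp h
      simpa [hPl] using this
    have := hP _ h'
    rw [sub_eq_zero] at this
    exact (WithLp.ofLp_injective 2) this  -- `ofLp` is injective
  set K : Submodule 𝕜 (EuclideanSpace 𝕜 m) := LinearMap.range Pl with hK
  have hKdim : finrank 𝕜 K = Fintype.card k := by
    rw [hK, LinearMap.finrank_range_of_inj hPinj, finrank_euclideanSpace]
  -- the hypothesis on `K`
  have hKW : ∀ x ∈ K, ‖toEuclideanLin A x - (ρ : 𝕜) • x‖ ^ 2 ≤
      τ * RCLike.re ⟪toEuclideanLin A x - (ρ : 𝕜) • x, x⟫_𝕜 := by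
    intro x hx
    obtain ⟨z, rfl⟩ := LinearMap.mem_range.1 hx
    set y : k → 𝕜 := ofLp z with hy
    have hres : toEuclideanLin A (Pl z) - (ρ : 𝕜) • Pl z = toLp 2 ((A * P - (ρ : 𝕜) • P) *ᵥ y) := by
      rw [hPl, toLpLin_toLp, Matrix.toLin'_apply, Matrix.sub_mulVec, Matrix.smul_mulVec,
        ← Matrix.mulVec_mulVec, toLp_sub, toLp_smul]
    rw [hres, EuclideanSpace.norm_sq_eq, hPl, EuclideanSpace.inner_toLp_toLp, dotProduct_comm]
    have h := hL y
    simpa [dotProduct, mul_comm] using h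
  have h := finrank_le_card_abs_isHermitian_eigenvalues_sub_le hA K (μ := ρ + τ / 2) (ρ := |τ| / 2)
    (fun x hx => by
      have hx' := hKW x hx
      have hsq : ‖toEuclideanLin A x - ((ρ + τ / 2 : ℝ) : 𝕜) • x‖ ^ 2 ≤ (|τ| / 2 * ‖x‖) ^ 2 := by
        have hτ : (|τ| / 2) ^ 2 = (τ / 2) ^ 2 := by rw [div_pow, div_pow, sq_abs]
        rw [norm_sq_sub_center (toEuclideanLin A) ρ τ x, mul_pow, hτ]
        nlinarith [hx']
      exact (pow_le_pow_iff_left₀ (norm_nonneg _) (by positivity) two_ne_zero).1 hsq)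
  rwa [hKdim] at h

end Matrix

end Literature.Analysis.InnerProduct
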